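import Summits.ValiantsHypothesis.ValiantsHypothesis.Theorems.KPlusLogSqLawTridiagonalRealStaticPotentialGameDefs
import Summits.ValiantsHypothesis.ValiantsHypothesis.Theorems.KPlusLogSqLawTridiagonalRealStaticPotentialRow

/-!
# Route «KPlusLogSqLaw», crux `WeakLifting` (stmt-ValiantsHypothesis-19561) — REAL side of the tridiagonal sector:
# THE CAP OF THE HIERARCHICAL LIMIT — one relaxed move raises the potential by at most two, so every play has `#q ≤ 2(m − 1)`

HONEST FRAMING.  Helper (`--supports stmt-ValiantsHypothesis-19561 --as helper`), seat val-sym-lift-p3 (g10), cell `pub-symmetroid`,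
2026-08-27.  KERNEL VERSION of the seat memo HIERARCHICAL-LIMIT-GAME-liftp3g9.md §3b («THEOREM (paper; exhaustively machine-checked to 6
moves): no play of the limit game exceeds `2m − 2`», the desk's PROGRESS #2 of lift-p3 g9, recorded as a PAPER theorem in R2241/R2314): for
the RELAXED WORD GAME (`…PotentialGameDefs`: `IsRelaxedMove`, `RelaxedReach`) and the potential `theta` (`…PotentialDefs`),
* `theta_le_of_isRelaxedMove` — **`Θ(w') ≤ Θ(w) + 2` for every relaxed move `w ↦ w'`** (type I and its mirror image type II);
* `theta_le_of_relaxedReach`, `count_true_le_of_relaxedReach` — **after `n` moves from the empty word `Θ ≤ 2n`, hence `#q ≤ 2n`**: in the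
  game's reading (`n = m − 1` edges appended to `(D₀, D₁)`), `Z(p_m) ≤ 2m − 2` for EVERY play — the hierarchical mechanism class (boost and
  detector ladders, two-sided schedules, the pump-and-harvest family reaching `2m − 6`) has slope at most `2` IN THE MODEL.
PROOF (labelings, not blocks): `Θ(w) = max_λ (agreements − changes)`; for a label list `l = l_P ++ l_T ++ l_S` of `φ(u) ++ T ++ ψ(v)` the
tight-pair region scores at most one agreement per pair beyond its own changes (`agreements_pairWord_le`), `T` at most one, and `ψ(v)`
scores what `v` scores against `ψ(l_S)`; the label list `q^{|u|} ++ ψ(l_S)` of `u ++ v` collects `#q(u) +` the same with at most one extra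
change — whence `+2`.  The interface `agreements_le_theta_add_changes` / `theta_le_of_forall` evaluates the `Finset.sup` definition of `theta`
on label lists (`card_filter_agree_eq`, `card_filter_change_eq`); `theta_reverse` gives type II.
WHAT THIS IS NOT: the faithfulness of the game to finite designs (memo §1: first-order displacement signs, one transition zero per edge) is
located/paper and NOT claimed here; this file bounds the MODEL, not the sector — the sector's upper side is conjecture (P)
(`…PotentialRow`).  Nothing here bears on `WeakLifting` / `TropicalB` (stmt-19771) in their windows, on Conjecture B, on the Door-A
registers, on `MatrixDescartes` (stmt-ValiantsHypothesis-18050) or on VP ≠ VNP.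
[this cell's memo HIERARCHICAL-LIMIT-GAME-liftp3g9.md §3b; folklore (words, labelings)]
-/

-- `Summit.ValiantsHypothesis.ValiantsHypothesis.…` repeats a component by the D-0017 layout (single-conjunct summit); the name is mandated.
set_option linter.dupNamespace false
set_option autoImplicit false

namespace Summit.ValiantsHypothesis.ValiantsHypothesis.Theorems.KPlusLogSqLaw

namespace StaticTridiagonalRealPotential

open Finset

/-! ### List-level bookkeeping -/

/-- No agreements against the empty word. [bookkeeping] -/
@[simp] theorem agreements_nil_left (l : List Bool) : agreements [] l = 0 := by cases l <;> rfl
/-- No agreements against the empty label list. [bookkeeping] -/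
@[simp] theorem agreements_nil_right (w : List Bool) : agreements w [] = 0 := by cases w <;> rfl
/-- Agreements, head step. [bookkeeping] -/
@[simp] theorem agreements_cons (a b : Bool) (w l : List Bool) :
    agreements (a :: w) (b :: l) = (if a = b then 1 else 0) + agreements w l := rfl
/-- The empty label list has no change. [bookkeeping] -/
@[simp] theorem changes_nil : changes [] = 0 := rfl
/-- A single label has no change. [bookkeeping] -/
@[simp] theorem changes_singleton (a : Bool) : changes [a] = 0 := rfl
/-- Changes, head step. [bookkeeping] -/
@[simp] theorem changes_cons_cons (a b : Bool) (l : List Bool) :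
    changes (a :: b :: l) = (if a = b then 0 else 1) + changes (b :: l) := rfl

/-- Agreements never exceed the number of labels. [bookkeeping] -/
theorem agreements_le_length_right : ∀ (w l : List Bool), agreements w l ≤ l.length
  | [], l => by simp
  | a :: w, [] => by simp
  | a :: w, b :: l => by
    rw [agreements_cons, List.length_cons]
    have := agreements_le_length_right w l
    split_ifs <;> omega

/-- Agreements are additive over concatenation (matching lengths on the left). [bookkeeping] -/
theorem agreements_append : ∀ (w₁ l₁ w₂ l₂ : List Bool), l₁.length = w₁.length →
    agreements (w₁ ++ w₂) (l₁ ++ l₂) = agreements w₁ l₁ + agreements w₂ l₂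
  | [], [], w₂, l₂, _ => by simp
  | [], _ :: _, _, _, h => by simp at h
  | _ :: _, [], _, _, h => by simp at h
  | a :: w₁, b :: l₁, w₂, l₂, h => by
    rw [List.cons_append, List.cons_append, agreements_cons, agreements_cons,
      agreements_append w₁ l₁ w₂ l₂ (by simpa using h), Nat.add_assoc]

/-- Prepending one label adds at most one change. [bookkeeping] -/
theorem changes_cons_le (a : Bool) : ∀ (l : List Bool), changes (a :: l) ≤ changes l + 1
  | [] => by simp
  | b :: l => by rw [changes_cons_cons]; split_ifs <;> omega

/-- Prepending one label removes no change. [bookkeeping] -/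
theorem changes_le_cons (a : Bool) : ∀ (l : List Bool), changes l ≤ changes (a :: l)
  | [] => by simp
  | b :: l => by rw [changes_cons_cons]; omega

/-- Concatenation adds at most one change (the junction). [bookkeeping] -/
theorem changes_append_le : ∀ (l₁ l₂ : List Bool), changes (l₁ ++ l₂) ≤ changes l₁ + changes l₂ + 1
  | [], l₂ => by simp
  | [a], l₂ => by simpa using changes_cons_le a l₂
  | a :: b :: l₁, l₂ => by
    have ih := changes_append_le (b :: l₁) l₂
    simp only [List.cons_append, changes_cons_cons] at ih ⊢
    omega

/-- Changes are superadditive over concatenation. [bookkeeping] -/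
theorem le_changes_append : ∀ (l₁ l₂ : List Bool), changes l₁ + changes l₂ ≤ changes (l₁ ++ l₂)
  | [], l₂ => by simp
  | [a], l₂ => by simpa using changes_le_cons a l₂
  | a :: b :: l₁, l₂ => by
    have ih := le_changes_append (b :: l₁) l₂
    simp only [List.cons_append, changes_cons_cons] at ih ⊢
    omega

/-- The constant labeling `q` collects exactly the `q`-letters. [bookkeeping] -/
theorem agreements_replicate_true : ∀ (u : List Bool), agreements u (List.replicate u.length true) = u.count true
  | [] => by simp
  | a :: u => by
    rw [List.length_cons, List.replicate_succ, agreements_cons, agreements_replicate_true u, List.count_cons]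
    cases a <;> simp [Nat.add_comm]

/-- A constant labeling has no change. [bookkeeping] -/
theorem changes_replicate (n : ℕ) (a : Bool) : changes (List.replicate n a) = 0 := by
  induction n with
  | zero => rfl
  | succ n ih =>
    rcases n with _ | n
    · rfl
    · rw [List.replicate_succ, List.replicate_succ, changes_cons_cons, if_pos rfl, ← List.replicate_succ, ih]

/-- `ψ([]) = []`. [bookkeeping] -/
@[simp] theorem swapWord_nil : swapWord [] = [] := rfl
/-- `ψ`, head step. [bookkeeping] -/
@[simp] theorem swapWord_cons (a : Bool) (v : List Bool) : swapWord (a :: v) = (!a) :: swapWord v := rfl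
/-- `ψ` preserves the length. [bookkeeping] -/
@[simp] theorem length_swapWord (v : List Bool) : (swapWord v).length = v.length := List.length_map _
/-- `ψ` is an involution. [bookkeeping] -/
theorem swapWord_swapWord (v : List Bool) : swapWord (swapWord v) = v := by
  induction v with
  | nil => rfl
  | cons a v ih => simp [ih]

/-- Swap invariance of agreements: `ψ(v)` scores against `l` what `v` scores against `ψ(l)`. [bookkeeping] -/
theorem agreements_swapWord : ∀ (v l : List Bool), agreements (swapWord v) l = agreements v (swapWord l)
  | [], l => by simp
  | a :: v, [] => by simp
  | a :: v, b :: l => by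
    rw [swapWord_cons, swapWord_cons, agreements_cons, agreements_cons, agreements_swapWord v l]
    cases a <;> cases b <;> rfl

/-- `ψ` preserves the changes of a label list. [bookkeeping] -/
theorem changes_swapWord : ∀ (l : List Bool), changes (swapWord l) = changes l
  | [] => rfl
  | [a] => rfl
  | a :: b :: l => by
    have := changes_swapWord (b :: l)
    rw [swapWord_cons] at this
    rw [swapWord_cons, swapWord_cons, changes_cons_cons, changes_cons_cons, this]
    cases a <;> cases b <;> rfl

/-- The pair word has one `q` per `q` of `u`: `#q(φ(u)) = #q(u)`. [memo §3b] -/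
theorem count_true_pairWord : ∀ (u : List Bool) (o : ℕ → Bool), (pairWord u o).count true = u.count true
  | [], o => rfl
  | false :: u, o => by rw [pairWord, count_true_pairWord u]; simp
  | true :: u, o => by
    rw [pairWord, List.count_append, count_true_pairWord u]
    rcases Bool.eq_false_or_eq_true (o 0) with h | h <;> simp [h, Nat.add_comm]

/-- The pair word has length `2·#q(u)`. [bookkeeping] -/
theorem length_pairWord : ∀ (u : List Bool) (o : ℕ → Bool), (pairWord u o).length = 2 * u.count true
  | [], o => rfl
  | false :: u, o => by rw [pairWord, length_pairWord u]; simp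
  | true :: u, o => by
    rw [pairWord, List.length_append, length_pairWord u]
    rcases Bool.eq_false_or_eq_true (o 0) with h | h <;> simp [h] <;> ring

/-- **The tight-pair region**: against ANY label list, the pair word scores at most one agreement per pair beyond the label changes
(a pair inside one block yields one letter; a pair cut by a block boundary yields at most two but costs a change). -/
theorem agreements_pairWord_le : ∀ (u : List Bool) (o : ℕ → Bool) (l : List Bool),
    agreements (pairWord u o) l ≤ u.count true + changes l
  | [], o, l => by simp [pairWord]
  | false :: u, o, l => by
    rw [pairWord]
    simpa using agreements_pairWord_le u (fun n => o (n + 1)) l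
  | true :: u, o, l => by
    rw [pairWord]
    have ih := agreements_pairWord_le u (fun n => o (n + 1))
    rcases l with _ | ⟨b₁, _ | ⟨b₂, l⟩⟩
    · simp
    · -- a single label: at most one agreement in total
      have h := agreements_le_length_right ((if o 0 then [false, true] else [true, false]) ++ pairWord u fun n => o (n + 1)) [b₁]
      simp only [List.length_singleton] at h
      simp only [List.count_cons_self, changes_singleton]
      omega
    · have h2 := ih l
      have hc := changes_le_cons b₁ (b₂ :: l)
      have hc' := changes_le_cons b₂ l
      split_ifs with ho
      · simp only [List.cons_append, List.nil_append, agreements_cons, List.count_cons_self, changes_cons_cons]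
        cases b₁ <;> cases b₂ <;> simp <;> omega
      · simp only [List.cons_append, List.nil_append, agreements_cons, List.count_cons_self, changes_cons_cons]
        cases b₁ <;> cases b₂ <;> simp <;> omega

/-- Reversal invariance of agreements. [bookkeeping] -/
theorem agreements_reverse : ∀ (w l : List Bool), l.length = w.length →
    agreements w.reverse l.reverse = agreements w l
  | [], [], _ => by simp
  | [], _ :: _, h => by simp at h
  | _ :: _, [], h => by simp at h
  | a :: w, b :: l, h => by
    have h' : l.length = w.length := by simpa using h
    rw [List.reverse_cons, List.reverse_cons, agreements_append _ _ _ _ (by simp [h']), agreements_reverse w l h',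
      agreements_cons, agreements_cons, agreements_nil_left, Nat.add_zero, Nat.add_comm]

/-- Changes of a label list extended by two labels at the end. [bookkeeping] -/
theorem changes_append_singleton_singleton (l : List Bool) (a b : Bool) :
    changes (l ++ [a] ++ [b]) = changes (l ++ [a]) + (if a = b then 0 else 1) := by
  induction l with
  | nil => simp
  | cons c l ih =>
    rcases l with _ | ⟨d, l⟩
    · simp [Nat.add_comm]
    · simp only [List.cons_append] at ih ⊢
      rw [changes_cons_cons, changes_cons_cons, ih, Nat.add_assoc]

/-- Reversal invariance of changes. [bookkeeping] -/
theorem changes_reverse : ∀ (l : List Bool), changes l.reverse = changes l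
  | [] => rfl
  | [a] => rfl
  | a :: b :: l => by
    have h := changes_reverse (b :: l)
    rw [List.reverse_cons] at h
    rw [List.reverse_cons, List.reverse_cons, changes_append_singleton_singleton, h, changes_cons_cons]
    cases a <;> cases b <;> simp [Nat.add_comm]

/-! ### The potential through label lists -/

/-- The agreement count of `theta` (over `Fin w.length`) is `agreements w (List.ofFn lab)`. [bookkeeping] -/
theorem card_filter_agree_eq : ∀ (w : List Bool) (lab : Fin w.length → Bool),
    (Finset.univ.filter fun i : Fin w.length => w.get i = lab i).card = agreements w (List.ofFn lab)
  | [], lab => by simp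
  | a :: w, lab => by
    show (Finset.univ.filter fun i : Fin (w.length + 1) => (a :: w).get i = lab i).card = _
    have e0 : (a :: w).get 0 = a := rfl
    have es : ∀ x : Fin w.length, (a :: w).get x.succ = w.get x := fun x => rfl
    rw [Fin.card_filter_univ_succ' (fun i : Fin (w.length + 1) => (a :: w).get i = lab i), List.ofFn_succ, agreements_cons,
      ← card_filter_agree_eq w (fun i => lab i.succ)]
    simp only [e0, es]

/-- Changes of `List.ofFn f`, head step (`Fin (n+2)`). [bookkeeping] -/
theorem changes_ofFn_succ_succ {n : ℕ} (f : Fin (n + 2) → Bool) :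
    changes (List.ofFn f) = (if f 0 = f (Fin.succ 0) then 0 else 1) + changes (List.ofFn fun i : Fin (n + 1) => f i.succ) := by
  have h1 : List.ofFn f = f 0 :: List.ofFn (fun i : Fin (n + 1) => f i.succ) := List.ofFn_succ
  have h2 : List.ofFn (fun i : Fin (n + 1) => f i.succ) = f (Fin.succ 0) :: List.ofFn (fun i : Fin n => f i.succ.succ) :=
    List.ofFn_succ
  rw [h1, h2, changes_cons_cons]

/-- The change count of `theta` (over `Fin w.length`) is `changes (List.ofFn lab)`. [bookkeeping] -/
theorem card_filter_change_eq : ∀ (w : List Bool) (lab : Fin w.length → Bool),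
    (Finset.univ.filter fun i : Fin w.length => ∃ h : (i : ℕ) + 1 < w.length, lab i ≠ lab ⟨(i : ℕ) + 1, h⟩).card =
      changes (List.ofFn lab)
  | [], lab => by simp
  | [a], lab => by
    rw [List.ofFn_succ, List.ofFn_zero, changes_singleton]
    refine Finset.card_eq_zero.2 (Finset.eq_empty_of_forall_notMem fun x hx => ?_)
    obtain ⟨h, -⟩ := (Finset.mem_filter.1 hx).2
    have hx' := x.isLt
    simp only [List.length_cons, List.length_nil] at h hx'
    omega
  | a :: b :: w, lab => by
    have IH : (Finset.univ.filter fun i : Fin (b :: w).length =>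
        ∃ h : (i : ℕ) + 1 < (b :: w).length, lab i.succ ≠ lab (⟨(i : ℕ) + 1, h⟩ : Fin (b :: w).length).succ).card =
        changes (List.ofFn fun i : Fin (w.length + 1) => lab i.succ) :=
      card_filter_change_eq (b :: w) (fun i => lab i.succ)
    have step : changes (List.ofFn lab) =
        (if lab 0 = lab (Fin.succ 0) then 0 else 1) + changes (List.ofFn fun i : Fin (w.length + 1) => lab i.succ) :=
      changes_ofFn_succ_succ (n := w.length) lab
    rw [step, ← IH]
    show (Finset.univ.filter fun i : Fin ((b :: w).length + 1) =>
      ∃ h : (i : ℕ) + 1 < (a :: b :: w).length, lab i ≠ lab ⟨(i : ℕ) + 1, h⟩).card = _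
    rw [Fin.card_filter_univ_succ' (fun i : Fin ((b :: w).length + 1) =>
        ∃ h : (i : ℕ) + 1 < (a :: b :: w).length, lab i ≠ lab ⟨(i : ℕ) + 1, h⟩)]
    congr 1
    · have e1 : ∀ h, (⟨((0 : Fin ((b :: w).length + 1)) : ℕ) + 1, h⟩ : Fin (a :: b :: w).length) = Fin.succ 0 :=
        fun h => Fin.ext (by simp)
      have e2 : ((0 : Fin ((b :: w).length + 1)) : ℕ) + 1 < (a :: b :: w).length := by simp
      simp only [e1, ne_eq, e2, exists_true_left]
      by_cases hq : lab 0 = lab (Fin.succ 0)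
      · rw [if_pos hq, if_neg (not_not.2 hq)]
      · rw [if_neg hq, if_pos hq]
    · congr 1
      have e3 : (a :: b :: w).length = w.length + 2 := rfl
      have e4 : (b :: w).length = w.length + 1 := rfl
      refine Finset.filter_congr fun x _ => ⟨fun ⟨h, hne⟩ => ⟨?_, hne⟩, fun ⟨h, hne⟩ => ⟨?_, hne⟩⟩
      · have e5 : ((x.succ : Fin ((b :: w).length + 1)) : ℕ) = x + 1 := rfl
        have := x.isLt
        omega
      · have e5 : ((x.succ : Fin ((b :: w).length + 1)) : ℕ) = x + 1 := rfl
        omega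

/-- **Agreements never exceed the potential plus the changes**: for every label list of the right length,
`agreements w l ≤ Θ(w) + changes l`. -/
theorem agreements_le_theta_add_changes (w l : List Bool) (hl : l.length = w.length) :
    agreements w l ≤ theta w + changes l := by
  classical
  have hlab : List.ofFn (fun i : Fin w.length => l.get ⟨i, by rw [hl]; exact i.isLt⟩) = l := by
    apply List.ext_get (by simp [hl]) fun n h₁ h₂ => by simp
  have hle : (Finset.univ.filter fun i : Fin w.length => w.get i = (fun i : Fin w.length => l.get ⟨i, by rw [hl]; exact i.isLt⟩) i).card -
      (Finset.univ.filter fun i : Fin w.length => ∃ h : (i : ℕ) + 1 < w.length,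
        (fun i : Fin w.length => l.get ⟨i, by rw [hl]; exact i.isLt⟩) i ≠ (fun i : Fin w.length => l.get ⟨i, by rw [hl]; exact i.isLt⟩) ⟨(i : ℕ) + 1, h⟩).card ≤ theta w := by
    unfold theta
    exact Finset.le_sup (f := fun lab : Fin w.length → Bool =>
      (Finset.univ.filter fun i : Fin w.length => w.get i = lab i).card -
        (Finset.univ.filter fun i : Fin w.length => ∃ h : (i : ℕ) + 1 < w.length, lab i ≠ lab ⟨(i : ℕ) + 1, h⟩).card)
      (Finset.mem_univ _)
  rw [card_filter_agree_eq, card_filter_change_eq, hlab] at hle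
  omega

/-- **Bounding the potential through label lists**: if every label list of the right length satisfies `agreements w l ≤ B + changes l`,
then `Θ(w) ≤ B`. -/
theorem theta_le_of_forall (w : List Bool) (B : ℕ) (h : ∀ l : List Bool, l.length = w.length → agreements w l ≤ B + changes l) :
    theta w ≤ B := by
  classical
  unfold theta
  refine Finset.sup_le fun lab _ => ?_
  have h1 := h (List.ofFn lab) (List.length_ofFn)
  rw [← card_filter_agree_eq, ← card_filter_change_eq] at h1
  exact tsub_le_iff_right.2 h1

/-- `Θ` is invariant under reversal. -/
theorem theta_reverse (w : List Bool) : theta w.reverse = theta w := by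
  apply le_antisymm
  · refine theta_le_of_forall _ _ fun l hl => ?_
    have h := agreements_le_theta_add_changes w l.reverse (by simpa using hl)
    rw [← agreements_reverse w l.reverse (by simpa using hl), List.reverse_reverse, changes_reverse] at h
    exact h
  · refine theta_le_of_forall _ _ fun l hl => ?_
    have h := agreements_le_theta_add_changes w.reverse l.reverse (by simpa using hl)
    rw [agreements_reverse w l (by simpa using hl), changes_reverse] at h
    exact h

/-! ### The cap: one relaxed move raises the potential by at most two -/

/-- **Type I move raises the potential by at most two.**  For a label list `l = l_P ++ l_T ++ l_S` of `φ(u) ++ T ++ ψ(v)`: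
the pair region scores `≤ #q(u) + changes l_P`, `T` scores `≤ 1`, and `ψ(v)` scores `agreements v (ψ l_S)`; the label list
`q^{|u|} ++ ψ(l_S)` of `u ++ v` scores `#q(u) + agreements v (ψ l_S)` with at most `changes l_S + 1` changes. -/
theorem theta_move_le (u v : List Bool) (o : ℕ → Bool) (T : List Bool) (hT : T = [] ∨ T = [true]) :
    theta (pairWord u o ++ T ++ swapWord v) ≤ theta (u ++ v) + 2 := by
  refine theta_le_of_forall _ _ fun l hl => ?_
  have hTlen : T.length ≤ 1 := by rcases hT with rfl | rfl <;> simp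
  have hlen : l.length = (pairWord u o).length + T.length + v.length := by
    rw [hl]; simp only [List.length_append, length_swapWord]
  -- split the label list along the three regions
  obtain ⟨lP, lT, lS, rfl, hlP, hlT⟩ : ∃ lP lT lS : List Bool, l = lP ++ lT ++ lS ∧
      lP.length = (pairWord u o).length ∧ lT.length = T.length :=
    ⟨l.take (pairWord u o).length, (l.drop (pairWord u o).length).take T.length, (l.drop (pairWord u o).length).drop T.length,
      by rw [List.append_assoc, List.take_append_drop, List.take_append_drop],
      by rw [List.length_take]; omega, by rw [List.length_take, List.length_drop]; omega⟩
  have hlS : lS.length = v.length := by simp only [List.length_append] at hlen; omega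
  -- the three regions of the new word
  have hagr : agreements (pairWord u o ++ T ++ swapWord v) (lP ++ lT ++ lS) =
      agreements (pairWord u o) lP + agreements T lT + agreements (swapWord v) lS := by
    rw [agreements_append _ _ _ _ (by simp [hlP, hlT]), agreements_append _ _ _ _ hlP]
  have hch : changes lP + changes lT + changes lS ≤ changes (lP ++ lT ++ lS) :=
    (Nat.add_le_add_right (le_changes_append lP lT) _).trans (le_changes_append _ _)
  have h1 := agreements_pairWord_le u o lP
  have h2 : agreements T lT ≤ 1 := (agreements_le_length_right T lT).trans (by omega)
  have h3 := agreements_swapWord v lS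
  -- the comparison label list of the old word
  have hold := agreements_le_theta_add_changes (u ++ v) (List.replicate u.length true ++ swapWord lS) (by simp [hlS])
  rw [agreements_append _ _ _ _ (by simp), agreements_replicate_true] at hold
  have hch' := changes_append_le (List.replicate u.length true) (swapWord lS)
  rw [changes_replicate, changes_swapWord] at hch'
  rw [hagr]
  omega

/-- **ONE RELAXED MOVE RAISES THE POTENTIAL BY AT MOST TWO** (type II is the mirror image of type I; `Θ` is reversal-invariant). -/
theorem theta_le_of_isRelaxedMove {w w' : List Bool} (h : IsRelaxedMove w w') : theta w' ≤ theta w + 2 := by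
  obtain ⟨u, v, o, T, hT, ⟨rfl, rfl⟩ | ⟨rfl, rfl⟩⟩ := h
  · exact theta_move_le u v o T hT
  · rw [theta_reverse, theta_reverse]
    exact theta_move_le u v o T hT

/-! ### The cap along a play -/

/-- **THE RELAXED WORD GAME CAP**: a word reachable from `[]` in `n` relaxed moves has potential at most `2n`. -/
theorem theta_le_of_relaxedReach : ∀ (n : ℕ) (w : List Bool), RelaxedReach n w → theta w ≤ 2 * n
  | 0, w, h => by
    have hw : w = [] := h
    rw [hw, theta_nil]
  | n + 1, w', h => by
    obtain ⟨w, hw, hmove⟩ := h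
    have := theta_le_of_relaxedReach n w hw
    exact (theta_le_of_isRelaxedMove hmove).trans (by omega)

/-- **Hence at most `2n` letters `q` after `n` moves** — in the hierarchical-limit reading (`n = m − 1` edges appended to the trivial pair
`(D₀, D₁)`): `Z(p_m) ≤ 2m − 2` for every play of the relaxed game, hence of the limit game it contains. -/
theorem count_true_le_of_relaxedReach {n : ℕ} {w : List Bool} (h : RelaxedReach n w) : w.count true ≤ 2 * n :=
  (count_le_theta w true).trans (theta_le_of_relaxedReach n w h)

/-- A sanity instance: the cap `2n` on the letter count is attained at `n = 1` (`[] ↦ [q]`) — the move relation is not vacuous. -/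
theorem relaxedReach_one_single : RelaxedReach 1 [true] :=
  ⟨[], rfl, [], [], (fun _ => true), [true], Or.inr rfl, Or.inl ⟨rfl, rfl⟩⟩

end StaticTridiagonalRealPotential

end Summit.ValiantsHypothesis.ValiantsHypothesis.Theorems.KPlusLogSqLaw
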